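import Summits.BirchSwinnertonDyer.BirchSwinnertonDyer.Theorems.KolyvaginDepthDoorDepthTableKurihara
import Summits.BirchSwinnertonDyer.BirchSwinnertonDyer.Theorems.KolyvaginDepthDoorDepthTableRankTwo389a1TwistBSDQuotientUniform
import Summits.BirchSwinnertonDyer.BirchSwinnertonDyer.Theorems.KolyvaginDepthDoorDepthTableRow389a1RankDischarged
import Summits.BirchSwinnertonDyer.Rank1Residual.Supersingular.CountPointsFast
import Summits.BirchSwinnertonDyer.Rank1Residual.Additive.X4ThreeKuriharaCertKernel
import Literature.NumberTheory.EllipticCurves.BSDSelmerPConverseSerreProofs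
import HarnessLib

/-!
# Route `KolyvaginDepthDoor`, crux `KolyvaginDepthSupplyKN` (stmt-BirchSwinnertonDyer-22820) —
# DEPTH TABLE v17, ROW `389a1` IN THE KURIHARA CURRENCY: the crux's clause at `389a1` modulo print and TWO
# IN-TREE KURIHARA CERTIFICATES (`p = 5`, `d_K = −7`) — no numerical datum owed; and the `p`-uniform row shape

Helper file of the lead prover of line `levelone` (kdd-p1 g21; `--supports stmt-BirchSwinnertonDyer-22820
--as helper`); it closes nothing and BSD is NOT proved by it.

The generic mechanism `cruxBody_of_kuriharaClaims_spade` (`KolyvaginDepthDoorDepthTableKurihara`) instantiated at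
the first curve of the table. The two Kurihara claims are those of the TREE'S OWN kernel-rechecked certificate
records (`Literature/NumberTheory/EllipticCurves/KuriharaCertificates/RecordsN000352to000389.lean`, theorem
`cert_389a1`, record `(p, n, ν, δ̃ mod p) = (5, 2501 = 41·61, 2, 2)`; `RecordsN019053to019073.lean`, theorem
`cert_19061a1` — Cremona's `19061a1 = [0, −1, 1, −114, −302]` IS the lineage's minimal model `T₀` of the Heegner
twist `389a1^{(−7)}` (`C389a1.minTwist7_smul_eq`) —, record `(5, 211, 1, 3)`; fleet job `j034590`, PARI
`msfromell`, symbol-table hashes in the records), read at level `N_E` through `KuriharaCertificates.Record.Claim`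
— i.e. the hypotheses `hδE`, `hδT` below are LITERALLY those records' claims. Everything else is decided in the
kernel here or was decided by the lineage: `#Ẽ(𝔽₄₁) = 45`, `#Ẽ(𝔽₆₁) = 70` (so `41, 61 ∈ 𝒫₁(E, 5)`: `ℓ ≡ 1`,
`a_ℓ ≡ 2 (mod 5)`, and `25 ∤ #Ẽ(𝔽_ℓ)`: cyclic `5`-part), `#T̃₀(𝔽₂₁₁) = 205` (`211 ∈ 𝒫₁(T, 5)`, cyclic),
`a_5(E) = −3 ≢ 1`, `a_5(T) = 3 ≢ 1` (non-anomalous), Kodaira–Néron for `E` and `T` at every `p ≥ 5`, `5` good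
ordinary with `ρ̄_{E,5}` onto (tower by Serre), `rank_ℤ E(ℚ) = 2` (kernel 2-descent, `mordellWeilRank_E_eq_two`),
`N_E = 389` prime (♠), Heegner data for `d_K = −7`.

* `cruxBody_of_kuriharaClaims_neg7_at` — THE `p`-UNIFORM ROW SHAPE at `389a1`, `d_K = −7`: for ANY admissible
  `p ≥ 5` (good ordinary, `ρ̄_{E,p}` onto, `a_p ≢ 1`), an E-side claim at a cyclic level `n` with `ν(n) ≤ 2` and a
  twist-side claim on `T₀` at a cyclic level `m` with `ν(m) ≤ 2` (and `a_p(T₀) ≢ 1`) give the clause at `389a1`.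
* `cruxBody_of_kuriharaClaims_5_neg7` — the instance at `p = 5` on the two tree records.

RESULT: for EVERY imaginary quadratic `K` with `d_K = −7`, the clause of `KolyvaginDepthSupplyKN` holds at
`W = 389a1` VERBATIM, CONDITIONAL on four named print facts — Kim 2026 Thm. 1.11 (`hKim`), modularity (`hnf`),
Mazur 1978 Cor. 4.1 (`hMaz`), W. Zhang 2014 L8.4 (1)/9.1 (`h84`; `5` is INERT in `ℚ(√−7)`, so the ♠ supply is
the one that applies) — and on the two record claims `hδE`, `hδT`. Compared with v13–v16 (Stein–Wuthrich Thm.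
1.1 + BCS 2025 Cor. 1.3.1 + GZK by name + ONE transcendental datum `ord_5(L'(T,1)/(Ω_T Reg_T)) ≤ 1` with
`r_an(T) = 1`, never supplied in the tree), the v17 row trades three print facts and the owed datum for ONE print
fact and two EXACT certificates already in the tree. Per curve; nothing class-wide (the open stub (S♭) is
untouched); BSD is NOT proved by it.

References: [Kim2022StructureSelmer] Thm. 1.11, §1.2.2, §1.4.3; [WZhang2014] Lemma 8.4 (1), Thm. 9.1;
[Mazur1978] Cor. 4.1; [Serre1972] §4.2, §5.4 Prop. 21; [CremonaAlgorithms1997] Table 1 (389a1), and Cremona's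
database (19061a1); [SilvermanAEC2009] VII.3.1, X.4.2.
-/

set_option linter.dupNamespace false

noncomputable section

open scoped Classical NumberField

namespace Summit.BirchSwinnertonDyer.BirchSwinnertonDyer.Theorems.KolyvaginDepthDoor

open Literature.NumberTheory.EllipticCurves Literature.NumberTheory.EllipticCurves.ModularForms
  WeierstrassCurve NumberField IsDedekindDomain
open Summit.BirchSwinnertonDyer.BirchSwinnertonDyer.Theorems
open Summit.BirchSwinnertonDyer.BirchSwinnertonDyer.Rank2Observatory
open Summit.BirchSwinnertonDyer.BirchSwinnertonDyer.Rank1Residual (IntModel.frobeniusTrace_eq)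
open Summit.BirchSwinnertonDyer.Rank1Residual.Supersingular (natCard_point_eq_of_countPoints countPoints_eq_of_fast)
open Summit.BirchSwinnertonDyer.Rank1Residual.Additive (card_torsion_le_of_intModel_of_card
  isKolyvaginPrime_of_intModel_of_card isKolyvaginProduct_mul)

namespace C389a1

/-! ## The `p`-uniform row shape at `389a1`, `d_K = −7` -/

/-- **THE v17 ROW SHAPE AT `389a1`, `d_K = −7`, UNIFORM IN THE PRIME.** `T₀ = [0, −1, 1, −114, −302]` the minimal
model of `389a1^{(−7)}` (`minTwist7_smul_eq`). For ANY prime `p ≥ 5` with `p` good ordinary for `E`, `ρ̄_{E,p}` onto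
(the tower by Serre 1972 §4.2 Thm. 2, tree `serre_hasSurjectiveModNGaloisRep_pow_holds`), `a_p(E) ≢ 1 (mod p)` and `p ≠ 7` (`p ∤ d_K`);
ANY imaginary quadratic `K` with `d_K = −7`; an E-side Kurihara claim at a cyclic level `n` with `ν(n) ≤ 2` and a
twist-side claim on `T₀` at a cyclic level `m` with `ν(m) ≤ 2`, `a_p(T₀) ≢ 1`: the clause of `KolyvaginDepthSupplyKN`
holds at `W = 389a1` VERBATIM. Kodaira–Néron (`kodairaNeron_of_five_le`, `minTwist7_kodairaNeron_of_five_le`), ♠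
(`spadeOne_of_prime`), `rank E = 2`, Heegner data are the lineage's kernel theorems. CONDITIONAL on Kim Thm. 1.11,
modularity, Mazur Cor. 4.1, W. Zhang L8.4 (1)/9.1 BY NAME and the two claims; per curve; BSD is not proved by it.
[cite: Kim2022StructureSelmer, Thm. 1.11 (PDF p. 8)] [cite: WZhang2014, Lemma 8.4 (1) (p. 236), Thm. 9.1 (p. 240)]
[cite: Serre1972, §4.2 Thm. 2] [cite: CremonaAlgorithms1997, Table 1 (389a1)] -/
theorem cruxBody_of_kuriharaClaims_neg7_at
    (hKim : Kim2022_card_selmerGroup_le_pow_of_kuriharaNumber_ne_zero)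
    (hnf : exists_isNewformOf) (hMaz : mazur_not_dvd_maninConstant_of_odd)
    (h84 : Literature.NumberTheory.EllipticCurves.WZhang2014_lemma84_exists_minimal_kolyvaginClass_one_selmerCard)
    (p : ℕ) [hp : Fact p.Prime] (h5 : 5 ≤ p) (hp7 : p ≠ 7)
    (hgood : haveI := curve389a1_isGloballyMinimal; Curve389a1.E.HasGoodReductionAtPrime p)
    (hord : haveI := curve389a1_isGloballyMinimal; ¬ (p : ℤ) ∣ Curve389a1.E.frobeniusTrace p)
    (hsurj : Curve389a1.E.HasSurjectiveModNGaloisRep p)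
    (hna : haveI := curve389a1_isGloballyMinimal; ¬ (p : ℤ) ∣ Curve389a1.E.frobeniusTrace p - 1)
    (K : Type) [Field K] [NumberField K] (hK : IsImaginaryQuadratic K) (hD : NumberField.discr K = -7)
    (n : ℕ) [NeZero n]
    (hn : haveI := curve389a1_isGloballyMinimal; IsCyclicKolyvaginLevel Curve389a1.E p n)
    (hν : n.primeFactors.card ≤ 2)
    (hδE : haveI := curve389a1_isGloballyMinimal; haveI := curve389a1_neZero_conductorNorm;
      ∀ (D : ModularParametrizationData Curve389a1.E (Curve389a1.E.conductorNorm ℤ)), ¬ (p : ℤ) ∣ D.maninConstant →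
        (∃ u : ℚ, ‖(u : ℚ_[p])‖ = 1 ∧ Curve389a1.E.realPeriodRat = u * plusPeriod D.f) →
        ∃ ψ : (ℓ : ℕ) → (ZMod ℓ)ˣ →* Multiplicative (ZMod p),
          (∀ ℓ ∈ n.primeFactors, Function.Surjective (ψ ℓ)) ∧ kuriharaNumber D.f p n ψ ≠ 0)
    (hTna : haveI := minTwist7_isGloballyMinimal;
      ¬ (p : ℤ) ∣ ((⟨0, -1, 1, -114, -302⟩ : WeierstrassCurve ℤ).map (Int.castRingHom ℚ)).frobeniusTrace p - 1)
    (m : ℕ) [NeZero m]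
    (hm : haveI := minTwist7_isGloballyMinimal;
      IsCyclicKolyvaginLevel ((⟨0, -1, 1, -114, -302⟩ : WeierstrassCurve ℤ).map (Int.castRingHom ℚ)) p m)
    (hμ : m.primeFactors.card ≤ 2)
    (hδT : haveI := minTwist7_isElliptic; haveI := minTwist7_isGloballyMinimal;
      haveI : NeZero (((⟨0, -1, 1, -114, -302⟩ : WeierstrassCurve ℤ).map (Int.castRingHom ℚ)).conductorNorm ℤ) :=
        neZero_conductorNorm_of_isElliptic _;
      ∀ (D : ModularParametrizationData ((⟨0, -1, 1, -114, -302⟩ : WeierstrassCurve ℤ).map (Int.castRingHom ℚ))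
          (((⟨0, -1, 1, -114, -302⟩ : WeierstrassCurve ℤ).map (Int.castRingHom ℚ)).conductorNorm ℤ)),
        ¬ (p : ℤ) ∣ D.maninConstant →
        (∃ u : ℚ, ‖(u : ℚ_[p])‖ = 1 ∧
          ((⟨0, -1, 1, -114, -302⟩ : WeierstrassCurve ℤ).map (Int.castRingHom ℚ)).realPeriodRat = u * plusPeriod D.f) →
        ∃ ψ : (ℓ : ℕ) → (ZMod ℓ)ˣ →* Multiplicative (ZMod p),
          (∀ ℓ ∈ m.primeFactors, Function.Surjective (ψ ℓ)) ∧ kuriharaNumber D.f p m ψ ≠ 0) :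
    haveI := curve389a1_isGloballyMinimal;
    ∃ (p : ℕ) (hp : Fact p.Prime), 5 ≤ p ∧ Curve389a1.E.HasGoodReductionAtPrime p ∧
      ¬ (p : ℤ) ∣ Curve389a1.E.frobeniusTrace p ∧ (∀ n : ℕ, Curve389a1.E.HasSurjectiveModNGaloisRep (p ^ n : ℕ)) ∧
      (∀ v : HeightOneSpectrum (𝓞 ℚ), Curve389a1.E.HasMultiplicativeReductionAt v →
        ¬ p ∣ Curve389a1.E.ordMinimalDiscriminant v) ∧
      ∃ (K : Type) (_ : Field K) (_ : NumberField K), IsImaginaryQuadratic K ∧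
        NumberField.discr K ≠ -3 ∧ NumberField.discr K ≠ -4 ∧
        ∃ (_ : NeZero (Curve389a1.E.conductorNorm ℤ)), SatisfiesHeegnerHypothesis (Curve389a1.E.conductorNorm ℤ) K ∧
        ∃ (Dt : ModularParametrizationData Curve389a1.E (Curve389a1.E.conductorNorm ℤ)) (β : ℤ) (ι : K →+* ℂ) (n₁ : ℕ)
          (d : KolyvaginHeegnerData Dt β ι n₁), Squarefree n₁ ∧
          (∀ q ∈ n₁.primeFactors, Zhang2014.IsKolyvaginPrime (Curve389a1.E.conductorNorm ℤ) Curve389a1.E K p q) ∧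
          d.kolyvaginClass hp.out 1 ≠ 0 ∧
          (n₁.primeFactors.card + 1 ≤ Curve389a1.E.mordellWeilRank ∨
            (n₁.primeFactors.card ≤ Curve389a1.E.mordellWeilRank ∧
              n₁.primeFactors.card + 1 ≤ (Curve389a1.E.quadraticTwist (NumberField.discr K : ℚ)).mordellWeilRank)) := by
  haveI := curve389a1_isGloballyMinimal
  haveI iNZ := curve389a1_neZero_conductorNorm
  haveI := minTwist7_isElliptic
  haveI := minTwist7_isGloballyMinimal
  haveI iNZT : NeZero (((⟨0, -1, 1, -114, -302⟩ : WeierstrassCurve ℤ).map (Int.castRingHom ℚ)).conductorNorm ℤ) :=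
    neZero_conductorNorm_of_isElliptic _
  have hsp := spadeOne_of_prime p
  have hS2 : ¬ Squarefree (Curve389a1.E.conductorNorm ℤ) →
      (∃ (ℓ : ℕ) (_ : Fact ℓ.Prime), Curve389a1.E.HasMultiplicativeReductionAtPrime ℓ ∧
          ¬ p ∣ padicValInt ℓ Curve389a1.E.minimalDiscriminantInt) ∧
        ∃ (ℓ₁ ℓ₂ : ℕ) (_ : Fact ℓ₁.Prime) (_ : Fact ℓ₂.Prime), ℓ₁ ≠ ℓ₂ ∧
          Curve389a1.E.HasMultiplicativeReductionAtPrime ℓ₁ ∧ Curve389a1.E.HasMultiplicativeReductionAtPrime ℓ₂ :=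
    fun hns ↦ absurd (Curve389a1.E.isSemistable_iff_squarefree_conductorNorm.mp hsp.2) hns
  have hH : SatisfiesHeegnerHypothesis (Curve389a1.E.conductorNorm ℤ) K :=
    satisfiesHeegnerHypothesis_conductorNorm_of_intModel intModel K hK.1 hD heegner_neg7
  have hD3 : NumberField.discr K ≠ -3 := by rw [hD]; norm_num
  have hD4 : NumberField.discr K ≠ -4 := by rw [hD]; norm_num
  have hpD : ¬ ((p : ℤ) ∣ NumberField.discr K) := by
    rw [hD]
    intro h
    have h7 : (p : ℤ) ∣ (7 : ℤ) := by
      have h77 : (-7 : ℤ) = -(7 : ℤ) := by norm_num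
      rw [h77, dvd_neg] at h
      exact h
    have hp7' : p ∣ 7 := by exact_mod_cast h7
    exact hp7 ((Nat.prime_dvd_prime_iff_eq hp.out (by norm_num)).mp hp7')
  have htower : ∀ k : ℕ, Curve389a1.E.HasSurjectiveModNGaloisRep (p ^ k : ℕ) :=
    serre_hasSurjectiveModNGaloisRep_pow_holds Curve389a1.E p h5 hsurj
  have hC : (⟨1, (-2 : ℚ), (0 : ℚ), -((1 : ℚ) / 2)⟩ : WeierstrassCurve.VariableChange ℚ) •
      ((⟨0, -1, 1, -114, -302⟩ : WeierstrassCurve ℤ).map (Int.castRingHom ℚ)) =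
      Curve389a1.E.quadraticTwist (NumberField.discr K : ℚ) := by
    rw [hD]; push_cast; exact minTwist7_smul_eq
  have hrank : 2 ≤ Curve389a1.E.mordellWeilRank := Curve389a1.two_le_mordellWeilRank
  have hν' : n.primeFactors.card ≤ Curve389a1.E.mordellWeilRank := by rw [mordellWeilRank_E_eq_two]; exact hν
  have hμ' : m.primeFactors.card ≤ Curve389a1.E.mordellWeilRank := by rw [mordellWeilRank_E_eq_two]; exact hμ
  exact cruxBody_of_kuriharaClaims_spade hKim hnf hMaz h84 Curve389a1.E hrank p h5 hgood hord htower
    (kodairaNeron_of_five_le p h5) hna hsp.1 hS2 K hK hD3 hD4 hpD hH n hn hν' hδE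
    ((⟨0, -1, 1, -114, -302⟩ : WeierstrassCurve ℤ).map (Int.castRingHom ℚ)) _ hC hTna
    (minTwist7_kodairaNeron_of_five_le p h5) m hm hμ' hδT

/-! ## The E-side level `n = 2501 = 41·61` of the tree record `cert_389a1` at `p = 5` -/

/-- `#Ẽ(𝔽₄₁) = 45` for `E = 389a1` (`a_41 = −3 ≡ 2`, `41 ≡ 1 (mod 5)`, `25 ∤ 45`), kernel-decided (Euler's criterion by
binary exponentiation, `countPointsFast`). [cite: CremonaAlgorithms1997, Table 1 (389a1)] -/
theorem card_41 :
    Nat.card (((⟨0, 1, 1, -2, 0⟩ : WeierstrassCurve ℤ).map (Int.castRingHom (ZMod 41))).toAffine.Point) = 45 :=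
  haveI : Fact (Nat.Prime 41) := ⟨by norm_num⟩
  natCard_point_eq_of_countPoints 0 1 1 (-2) 0 41 (by norm_num) (by decide +kernel) (n := 45)
    (countPoints_eq_of_fast (by decide +kernel))

/-- `#Ẽ(𝔽₆₁) = 70` for `E = 389a1` (`a_61 = −8 ≡ 2`, `61 ≡ 1 (mod 5)`, `25 ∤ 70`), kernel-decided. [cite: CremonaAlgorithms1997, Table 1 (389a1)] -/
theorem card_61 :
    Nat.card (((⟨0, 1, 1, -2, 0⟩ : WeierstrassCurve ℤ).map (Int.castRingHom (ZMod 61))).toAffine.Point) = 70 :=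
  haveI : Fact (Nat.Prime 61) := ⟨by norm_num⟩
  natCard_point_eq_of_countPoints 0 1 1 (-2) 0 61 (by norm_num) (by decide +kernel) (n := 70)
    (countPoints_eq_of_fast (by decide +kernel))

/-- **`2501 = 41·61` is a CYCLIC KOLYVAGIN LEVEL for `(389a1, 5)`** (`41, 61 ∈ 𝒫₁`: `ℓ ∤ 389·5`, `ℓ ≡ 1`,
`a_ℓ ≡ ℓ + 1 (mod 5)`; cyclic `5`-parts: `25 ∤ 45, 70`) — the level of the tree record `cert_389a1` at `p = 5`.
[cite: Kim2022StructureSelmer, §1.2.2 (PDF p. 5)] -/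
theorem isCyclicKolyvaginLevel_5_2501 :
    haveI := curve389a1_isGloballyMinimal; haveI := Fact.mk (by norm_num : Nat.Prime 5);
    IsCyclicKolyvaginLevel Curve389a1.E 5 2501 := by
  haveI := curve389a1_isGloballyMinimal
  haveI := Fact.mk (by norm_num : Nat.Prime 5)
  haveI : Fact (Nat.Prime 41) := ⟨by norm_num⟩
  haveI : Fact (Nat.Prime 61) := ⟨by norm_num⟩
  have h41 : Kato.IsKolyvaginPrime Curve389a1.E 5 1 41 :=
    isKolyvaginPrime_of_intModel_of_card intModel 5 1 41 (by norm_num) (by decide +kernel) (by decide) card_41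
      (by norm_num)
  have h61 : Kato.IsKolyvaginPrime Curve389a1.E 5 1 61 :=
    isKolyvaginPrime_of_intModel_of_card intModel 5 1 61 (by norm_num) (by decide +kernel) (by decide) card_61
      (by norm_num)
  refine ⟨by simpa using isKolyvaginProduct_mul h41 h61 (by norm_num), fun ℓ hℓ hdvd ↦ ?_⟩
  have h2501 : (2501 : ℕ) = 41 * 61 := by norm_num
  rw [h2501] at hdvd
  rcases (Nat.Prime.dvd_mul hℓ.out).mp hdvd with h | h
  · obtain rfl := (Nat.prime_dvd_prime_iff_eq hℓ.out (by norm_num)).mp h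
    exact card_torsion_le_of_intModel_of_card intModel 5 41 card_41 (by norm_num)
  · obtain rfl := (Nat.prime_dvd_prime_iff_eq hℓ.out (by norm_num)).mp h
    exact card_torsion_le_of_intModel_of_card intModel 5 61 card_61 (by norm_num)

/-- **`5` is non-anomalous for `389a1`**: `a_5 = 5 + 1 − 9 = −3`, `5 ∤ a_5 − 1 = −4` (so `E(ℚ₅)[5] = 0`, AEC VII.3.1).
[cite: SilvermanAEC2009, VII.3 Prop. 3.1] -/
theorem nonAnomalous_5 :
    haveI := curve389a1_isGloballyMinimal; haveI := Fact.mk (by norm_num : Nat.Prime 5);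
    ¬ ((5 : ℕ) : ℤ) ∣ Curve389a1.E.frobeniusTrace 5 - 1 := by
  haveI := curve389a1_isGloballyMinimal
  haveI := Fact.mk (by norm_num : Nat.Prime 5)
  rw [IntModel.frobeniusTrace_eq intModel card_5]
  decide

/-! ## The twist-side level `m = 211` of the tree record `cert_19061a1` at `p = 5` (`19061a1 = T₀ = 389a1^{(−7)}`) -/

/-- `#T̃₀(𝔽₂₁₁) = 205` for `T₀ = [0, −1, 1, −114, −302]` (`a_211(T) = 7 ≡ 2`, `211 ≡ 1 (mod 5)`, `25 ∤ 205`),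
kernel-decided (`countPointsFast`). [cite: Kim2022StructureSelmer, §1.2.2 (PDF p. 5)] -/
theorem minTwist7_card_211 :
    Nat.card (((⟨0, -1, 1, -114, -302⟩ : WeierstrassCurve ℤ).map (Int.castRingHom (ZMod 211))).toAffine.Point) = 205 :=
  haveI : Fact (Nat.Prime 211) := ⟨by norm_num⟩
  natCard_point_eq_of_countPoints 0 (-1) 1 (-114) (-302) 211 (by norm_num) (by decide +kernel) (n := 205)
    (countPoints_eq_of_fast (by decide +kernel))

/-- **`211` is a CYCLIC KOLYVAGIN LEVEL for `(T₀, 5)`**, `T₀ = 389a1^{(−7)} = 19061a1` — the level of the tree record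
`cert_19061a1` at `p = 5`. [cite: Kim2022StructureSelmer, §1.2.2 (PDF p. 5)] -/
theorem minTwist7_isCyclicKolyvaginLevel_5_211 :
    haveI := minTwist7_isGloballyMinimal; haveI := Fact.mk (by norm_num : Nat.Prime 5);
    IsCyclicKolyvaginLevel ((⟨0, -1, 1, -114, -302⟩ : WeierstrassCurve ℤ).map (Int.castRingHom ℚ)) 5 211 := by
  haveI := minTwist7_isElliptic
  haveI := minTwist7_isGloballyMinimal
  haveI := Fact.mk (by norm_num : Nat.Prime 5)
  haveI : Fact (Nat.Prime 211) := ⟨by norm_num⟩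
  have h211 : Kato.IsKolyvaginPrime ((⟨0, -1, 1, -114, -302⟩ : WeierstrassCurve ℤ).map (Int.castRingHom ℚ)) 5 1 211 :=
    isKolyvaginPrime_of_intModel_of_card minTwist7_intModel 5 1 211 (by norm_num) (by decide +kernel) (by decide)
      minTwist7_card_211 (by norm_num)
  refine ⟨⟨Nat.squarefree_iff_nodup_primeFactorsList (by norm_num) |>.mpr (by simp), fun ℓ hℓ ↦ ?_⟩, fun ℓ hℓ hdvd ↦ ?_⟩
  · rw [show (211 : ℕ).primeFactors = {211} from (Nat.Prime.primeFactors (by norm_num)), Finset.mem_singleton] at hℓ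
    exact hℓ ▸ h211
  · obtain rfl := (Nat.prime_dvd_prime_iff_eq hℓ.out (by norm_num)).mp hdvd
    exact card_torsion_le_of_intModel_of_card minTwist7_intModel 5 211 minTwist7_card_211 (by norm_num)

/-- **`5` is non-anomalous for `T₀`**: `a_5(T) = 5 + 1 − 3 = 3`, `5 ∤ 2`. [cite: SilvermanAEC2009, VII.3 Prop. 3.1] -/
theorem minTwist7_nonAnomalous_5 :
    haveI := minTwist7_isGloballyMinimal; haveI := Fact.mk (by norm_num : Nat.Prime 5);
    ¬ ((5 : ℕ) : ℤ) ∣ ((⟨0, -1, 1, -114, -302⟩ : WeierstrassCurve ℤ).map (Int.castRingHom ℚ)).frobeniusTrace 5 - 1 := by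
  haveI := minTwist7_isElliptic
  haveI := minTwist7_isGloballyMinimal
  haveI := Fact.mk (by norm_num : Nat.Prime 5)
  rw [IntModel.frobeniusTrace_eq minTwist7_intModel minTwist7_card_5]
  decide

/-! ## The row at `p = 5`: the crux's clause at `389a1` from the two tree certificates -/

/-- **DEPTH-TABLE ROW `389a1`, `(p, d_K) = (5, −7)`, v17 — THE CRUX `KolyvaginDepthSupplyKN` AT `389a1` MODULO
PRINT AND TWO IN-TREE KURIHARA CERTIFICATES.** For EVERY imaginary quadratic `K` with `d_K = −7`: granted Kim
2026 Thm. 1.11 (`hKim`), modularity (`hnf`), Mazur 1978 Cor. 4.1 (`hMaz`), W. Zhang 2014 L8.4 (1)/9.1 (`h84`) BY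
NAME, and the CLAIMS of the tree records `cert_389a1` @ `(5, 41·61)` (`hδE`) and `cert_19061a1` @ `(5, 211)` (`hδT`)
— each read at level `N_E` through `KuriharaCertificates.Record.Claim`: «every datum with `5 ∤ c_D` and the period
transfer has a non-zero mod-`5` Kurihara number at that level» —, the clause of the crux holds at `W = 389a1`
VERBATIM (`cruxBody_of_kuriharaClaims_neg7_at 5` at `5` good ordinary `goodOrdinary_5`, `ρ̄_{E,5}` onto
`hasSurjectiveModNGaloisRep_5`, `nonAnomalous_5`, the levels `isCyclicKolyvaginLevel_5_2501`,
`minTwist7_isCyclicKolyvaginLevel_5_211`, `minTwist7_nonAnomalous_5`). CONDITIONAL on the four named facts and the two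
claims; per curve; nothing class-wide; BSD is not proved by it. [cite: Kim2022StructureSelmer, Thm. 1.11 (PDF p. 8)]
[cite: WZhang2014, Lemma 8.4 (1) (p. 236), Thm. 9.1 (p. 240)] [cite: Mazur1978, Cor. 4.1]
[cite: CremonaAlgorithms1997, Table 1 (389a1)] -/
theorem cruxBody_of_kuriharaClaims_5_neg7
    (hKim : Kim2022_card_selmerGroup_le_pow_of_kuriharaNumber_ne_zero)
    (hnf : exists_isNewformOf) (hMaz : mazur_not_dvd_maninConstant_of_odd)
    (h84 : Literature.NumberTheory.EllipticCurves.WZhang2014_lemma84_exists_minimal_kolyvaginClass_one_selmerCard)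
    (K : Type) [Field K] [NumberField K] (hK : IsImaginaryQuadratic K) (hD : NumberField.discr K = -7)
    (hδE : haveI := curve389a1_isGloballyMinimal; haveI := curve389a1_neZero_conductorNorm;
      haveI := Fact.mk (by norm_num : Nat.Prime 5);
      ∀ (D : ModularParametrizationData Curve389a1.E (Curve389a1.E.conductorNorm ℤ)), ¬ ((5 : ℕ) : ℤ) ∣ D.maninConstant →
        (∃ u : ℚ, ‖(u : ℚ_[5])‖ = 1 ∧ Curve389a1.E.realPeriodRat = u * plusPeriod D.f) →
        ∃ ψ : (ℓ : ℕ) → (ZMod ℓ)ˣ →* Multiplicative (ZMod 5),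
          (∀ ℓ ∈ (2501 : ℕ).primeFactors, Function.Surjective (ψ ℓ)) ∧ kuriharaNumber D.f 5 2501 ψ ≠ 0)
    (hδT : haveI := minTwist7_isElliptic; haveI := minTwist7_isGloballyMinimal;
      haveI : NeZero (((⟨0, -1, 1, -114, -302⟩ : WeierstrassCurve ℤ).map (Int.castRingHom ℚ)).conductorNorm ℤ) :=
        neZero_conductorNorm_of_isElliptic _;
      haveI := Fact.mk (by norm_num : Nat.Prime 5);
      ∀ (D : ModularParametrizationData ((⟨0, -1, 1, -114, -302⟩ : WeierstrassCurve ℤ).map (Int.castRingHom ℚ))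
          (((⟨0, -1, 1, -114, -302⟩ : WeierstrassCurve ℤ).map (Int.castRingHom ℚ)).conductorNorm ℤ)),
        ¬ ((5 : ℕ) : ℤ) ∣ D.maninConstant →
        (∃ u : ℚ, ‖(u : ℚ_[5])‖ = 1 ∧
          ((⟨0, -1, 1, -114, -302⟩ : WeierstrassCurve ℤ).map (Int.castRingHom ℚ)).realPeriodRat = u * plusPeriod D.f) →
        ∃ ψ : (ℓ : ℕ) → (ZMod ℓ)ˣ →* Multiplicative (ZMod 5),
          (∀ ℓ ∈ (211 : ℕ).primeFactors, Function.Surjective (ψ ℓ)) ∧ kuriharaNumber D.f 5 211 ψ ≠ 0) :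
    haveI := curve389a1_isGloballyMinimal;
    ∃ (p : ℕ) (hp : Fact p.Prime), 5 ≤ p ∧ Curve389a1.E.HasGoodReductionAtPrime p ∧
      ¬ (p : ℤ) ∣ Curve389a1.E.frobeniusTrace p ∧ (∀ n : ℕ, Curve389a1.E.HasSurjectiveModNGaloisRep (p ^ n : ℕ)) ∧
      (∀ v : HeightOneSpectrum (𝓞 ℚ), Curve389a1.E.HasMultiplicativeReductionAt v →
        ¬ p ∣ Curve389a1.E.ordMinimalDiscriminant v) ∧
      ∃ (K : Type) (_ : Field K) (_ : NumberField K), IsImaginaryQuadratic K ∧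
        NumberField.discr K ≠ -3 ∧ NumberField.discr K ≠ -4 ∧
        ∃ (_ : NeZero (Curve389a1.E.conductorNorm ℤ)), SatisfiesHeegnerHypothesis (Curve389a1.E.conductorNorm ℤ) K ∧
        ∃ (Dt : ModularParametrizationData Curve389a1.E (Curve389a1.E.conductorNorm ℤ)) (β : ℤ) (ι : K →+* ℂ) (n₁ : ℕ)
          (d : KolyvaginHeegnerData Dt β ι n₁), Squarefree n₁ ∧
          (∀ q ∈ n₁.primeFactors, Zhang2014.IsKolyvaginPrime (Curve389a1.E.conductorNorm ℤ) Curve389a1.E K p q) ∧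
          d.kolyvaginClass hp.out 1 ≠ 0 ∧
          (n₁.primeFactors.card + 1 ≤ Curve389a1.E.mordellWeilRank ∨
            (n₁.primeFactors.card ≤ Curve389a1.E.mordellWeilRank ∧
              n₁.primeFactors.card + 1 ≤ (Curve389a1.E.quadraticTwist (NumberField.discr K : ℚ)).mordellWeilRank)) := by
  haveI := curve389a1_isGloballyMinimal
  haveI iP := Fact.mk (by norm_num : Nat.Prime 5)
  haveI : NeZero (2501 : ℕ) := ⟨by norm_num⟩
  haveI : NeZero (211 : ℕ) := ⟨by norm_num⟩
  have hν : (2501 : ℕ).primeFactors.card ≤ 2 := by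
    rw [show (2501 : ℕ) = 41 * 61 from rfl, Nat.primeFactors_mul (by norm_num) (by norm_num),
      Nat.Prime.primeFactors (by norm_num), Nat.Prime.primeFactors (by norm_num)]
    decide
  have hμ : (211 : ℕ).primeFactors.card ≤ 2 := by
    rw [Nat.Prime.primeFactors (by norm_num), Finset.card_singleton]; omega
  exact cruxBody_of_kuriharaClaims_neg7_at hKim hnf hMaz h84 5 le_rfl (by norm_num) goodOrdinary_5.1 goodOrdinary_5.2
    hasSurjectiveModNGaloisRep_5 nonAnomalous_5 K hK hD 2501 isCyclicKolyvaginLevel_5_2501 hν hδE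
    minTwist7_nonAnomalous_5 211 minTwist7_isCyclicKolyvaginLevel_5_211 hμ hδT

end C389a1

end Summit.BirchSwinnertonDyer.BirchSwinnertonDyer.Theorems.KolyvaginDepthDoor

end
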